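import Summits.PneNP.PneNP.Theorems.ConvexRankGatesConvexGateBlindExactLiftingTriangleIsolation
import Summits.PneNP.PneNP.Theorems.ConvexRankGatesConvexGateBlindExactLiftingStrictLimit

/-!
# Triangle instance — rigidity of the cheap corner implies an ε-UNIFORM strict-rank jump

Support file for crux `ConvexGateBlind` (stmt-PneNP-10680), open stub `stub_exactLifting` (prover seat 0, session 28,
memo ANALYSIS13 §2). `M_t[x,w] = monoCount x w ∈ {1,3}`, `f_t(ε) = rk₊(M_t − εJ)`; the question of record is the
behaviour of `f_t(0⁺)` against the cheap corner `rk₊(M_t) ≤ 3t²` (lines).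

THE BRIDGE (`jump_of_lineRigid`). Let `t ≥ 3` and assume the purely algebraic RIGIDITY statement about the UNshifted
matrix (hypothesis `hR`, "R1" of memo ANALYSIS12 §3.3/§7): every non-negative factorisation of `M_t` with `3t²` rank-one
terms is the line factorisation — its terms are, up to a permutation of the index set, exactly the `3t²` line terms
`[L mono_x]·[w ∈ L]`. Then there is `ε₀ > 0` such that for every `ε ∈ (0, ε₀)` the shifted matrix `M_t − εJ` has NO
non-negative factorisation with `3t²` terms (`jump_of_lineRigid`), nor with fewer (`jump_of_lineRigid_fin`, padding by
zero terms): `f_t(ε) ≥ 3t² + 1` near `0⁺` — the first ε-uniform jump on the instance, reduced to R1 alone.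

PROOF. Compactness (`XorDoor.exists_limit_nmf`, file `…StrictLimit`): strict factorisations along `ε_n → 0⁺` converge,
term by term along a subsequence, to a `3t²`-term factorisation of `M_t`; by rigidity its terms are the line terms; so for
`n` large, after relabelling by the permutation and rescaling every column function to mean `1` on its line (its line mass
tends to `t > 0`), the row functions are uniformly within `10⁻⁵` of the line pattern, and THEOREM B (`isolation`, file
`…TriangleIsolation`: ε-uniform isolation of the line factorisation) forces `ε_n ≤ 0` — contradiction.
Registered sub-goal: `triangle_jump_of_rigidity` (self-contained signature).
-/

set_option linter.dupNamespace false -- `Summit.PneNP.PneNP.…`: summit = sub-problem (D-0017)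

namespace Summit.PneNP.PneNP.Theorems.XorDoor

open Filter Topology Finset

/-- **Lower semicontinuity of the strict rank** (any real matrix on finite index types): if the UNshifted matrix `m`
has no non-negative factorisation indexed by the finite type `ι`, then neither has `m − ε` for all sufficiently small
`ε > 0`. In rank language: `rk₊(m − εJ) ≥ rk₊(m)` near `0⁺` — the plain non-negative rank of the unshifted matrix is
a (weak) jumping invariant for the strict problem. -/
theorem noNMF_shift_of_noNMF {ι X W : Type} [Fintype ι] [Fintype X] [Fintype W] (m : X → W → ℝ)
    (h : ∀ (u : ι → X → ℝ) (v : ι → W → ℝ), (∀ i x, 0 ≤ u i x) → (∀ i w, 0 ≤ v i w) →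
      ¬ ∀ x w, ∑ i, u i x * v i w = m x w) :
    ∃ ε₀ : ℝ, 0 < ε₀ ∧ ∀ ε : ℝ, 0 < ε → ε < ε₀ → ∀ (u : ι → X → ℝ) (v : ι → W → ℝ),
      (∀ i x, 0 ≤ u i x) → (∀ i w, 0 ≤ v i w) → ¬ ∀ x w, ∑ i, u i x * v i w = m x w - ε := by
  classical
  by_contra hcon
  push Not at hcon
  have hseq : ∀ n : ℕ, ∃ ε : ℝ, 0 < ε ∧ ε < 1 / ((n : ℝ) + 1) ∧ ∃ (u : ι → X → ℝ) (v : ι → W → ℝ),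
      (∀ i x, 0 ≤ u i x) ∧ (∀ i w, 0 ≤ v i w) ∧ ∀ x w, ∑ i, u i x * v i w = m x w - ε := by
    intro n
    obtain ⟨ε, hε0, hε1, u, v, hu, hv, hf⟩ := hcon (1 / ((n : ℝ) + 1)) (by positivity)
    exact ⟨ε, hε0, hε1, u, v, hu, hv, hf⟩
  choose ε hε0 hε1 u v hu hv hf using hseq
  have hεlim : Tendsto ε atTop (𝓝 0) := by
    refine squeeze_zero (fun n => (hε0 n).le) (fun n => (hε1 n).le) ?_
    exact tendsto_one_div_add_atTop_nhds_zero_nat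
  obtain ⟨u₀, v₀, hu₀, hv₀, hf₀, -⟩ := exists_limit_nmf m ε hεlim u v hu hv hf
  exact h u₀ v₀ hu₀ hv₀ hf₀

end Summit.PneNP.PneNP.Theorems.XorDoor

namespace Summit.PneNP.PneNP.Theorems.XorDoor.TriLine

open Filter Topology Finset

noncomputable section

variable {t : ℕ}

/-- A non-negative factorisation of `M_t − εJ` with rank-one terms indexed by the finite type `ι`. -/
structure IsNMF (t : ℕ) {ι : Type} [Fintype ι] (ε : ℝ) (u : ι → Col t → ℝ) (v : ι → Tri t → ℝ) : Prop where
  u_nonneg : ∀ i x, 0 ≤ u i x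
  v_nonneg : ∀ i w, 0 ≤ v i w
  fact : ∀ x w, ∑ i, u i x * v i w = (monoCount x w : ℝ) - ε

/-- `lind` is an indicator -/
lemma lind_mul_self (L : Line t) (w : Tri t) : lind L w * lind L w = lind L w := by
  unfold lind; split_ifs <;> norm_num

/-- the all-`false` colouring: every line is monochromatic -/
def col0 (t : ℕ) : Col t := (fun _ => false, fun _ => false, fun _ => false)

/-- under the all-`false` colouring every line is monochromatic -/
lemma mInd_col0 (L : Line t) : mInd (col0 t) L = 1 := by
  unfold mInd
  rw [if_pos]
  rcases L with ⟨a, b⟩ | ⟨a, d⟩ | ⟨b, d⟩ <;> simp [col0]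

/-- **Rigidity ⇒ ε-uniform jump** (terms indexed by `Line t`, i.e. `3t²` of them). The hypothesis `hR` is R1 —
RIGIDITY OF THE CHEAP CORNER: every non-negative factorisation of the UNshifted triangle matrix `M_t` with `3t²` rank-one
terms (indexed, for convenience, by the type of lines itself) is the line factorisation: after a permutation `σ` of the
indices, the term with index `L` is exactly `[σ L mono_x]·[w ∈ σ L]` (open for `t ≥ 4`; false for `t ≤ 3`, where the
`t³ ≤ 3t²` points give other factorisations). -/
theorem jump_of_lineRigid (ht : 3 ≤ t)
    (hR : ∀ (u : Line t → Col t → ℝ) (v : Line t → Tri t → ℝ), IsNMF t 0 u v →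
      ∃ σ : Equiv.Perm (Line t), ∀ L x w, u L x * v L w = mInd x (σ L) * lind (σ L) w) :
    ∃ ε₀ : ℝ, 0 < ε₀ ∧ ∀ ε : ℝ, 0 < ε → ε < ε₀ →
      ∀ (u : Line t → Col t → ℝ) (v : Line t → Tri t → ℝ), ¬ IsNMF t ε u v := by
  classical
  by_contra hcon
  push Not at hcon
  -- a sequence of strict factorisations with shifts `ε n ∈ (0, 1/(n+1))`
  have hseq : ∀ n : ℕ, ∃ ε : ℝ, 0 < ε ∧ ε < 1 / ((n : ℝ) + 1) ∧
      ∃ (u : Line t → Col t → ℝ) (v : Line t → Tri t → ℝ), IsNMF t ε u v := by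
    intro n
    obtain ⟨ε, hε0, hε1, u, v, h⟩ := hcon (1 / ((n : ℝ) + 1)) (by positivity)
    exact ⟨ε, hε0, hε1, u, v, h⟩
  choose ε hε0 hε1 u v hNMF using hseq
  have hεlim : Tendsto ε atTop (𝓝 0) := by
    refine squeeze_zero (fun n => (hε0 n).le) (fun n => (hε1 n).le) ?_
    exact tendsto_one_div_add_atTop_nhds_zero_nat
  -- compactness: a limit factorisation of `M_t` with termwise convergence along a subsequence
  obtain ⟨u₀, v₀, hu₀, hv₀, hf₀, φ, hφ, hterm⟩ :=
    XorDoor.exists_limit_nmf (fun (x : Col t) (w : Tri t) => (monoCount x w : ℝ)) ε hεlim u v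
      (fun n => (hNMF n).u_nonneg) (fun n => (hNMF n).v_nonneg) (fun n => (hNMF n).fact)
  have h0 : IsNMF t 0 u₀ v₀ := ⟨hu₀, hv₀, fun x w => by rw [hf₀ x w, sub_zero]⟩
  -- rigidity: the limit is the line factorisation, up to the permutation `σ`
  obtain ⟨σ, hσ⟩ := hR u₀ v₀ h0
  set τ := σ.symm with hτ
  have hστ : ∀ L, σ (τ L) = L := fun L => σ.apply_symm_apply L
  -- relabelled terms converge to the line terms
  have hterm' : ∀ L x w, Tendsto (fun n => u (φ n) (τ L) x * v (φ n) (τ L) w) atTop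
      (𝓝 (mInd x L * lind L w)) := by
    intro L x w
    have := hterm (τ L) x w
    rwa [hσ (τ L) x w, hστ] at this
  -- line masses and the products `P n L x = u·mass → t·[L mono_x]`
  set mass : ℕ → Line t → ℝ := fun n L => ∑ w, lind L w * v (φ n) (τ L) w with hmass
  have hmass0 : ∀ n L, 0 ≤ mass n L :=
    fun n L => sum_nonneg fun w _ => mul_nonneg (lind_nonneg L w) ((hNMF (φ n)).v_nonneg _ _)
  have hP : ∀ L x, Tendsto (fun n => u (φ n) (τ L) x * mass n L) atTop (𝓝 (mInd x L * t)) := by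
    intro L x
    have h1 : ∀ n, u (φ n) (τ L) x * mass n L = ∑ w, lind L w * (u (φ n) (τ L) x * v (φ n) (τ L) w) := by
      intro n; simp only [hmass, mul_sum]; exact sum_congr rfl fun w _ => by ring
    have h2 : mInd x L * t = ∑ w, lind L w * (mInd x L * lind L w) := by
      have : ∑ w, lind L w * (mInd x L * lind L w) = mInd x L * ∑ w, lind L w * lind L w := by
        rw [mul_sum]; exact sum_congr rfl fun w _ => by ring
      rw [this]
      simp only [lind_mul_self, sum_lind L]
    simp only [h1]
    rw [h2]
    exact tendsto_finsetSum _ fun w _ => (hterm' L x w).const_mul _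
  -- eventually: every line mass is positive and every rescaled row is `10⁻⁵`-close to the pattern
  have ht0 : (0 : ℝ) < t := by exact_mod_cast (show 0 < t by omega)
  have hev1 : ∀ L, ∀ᶠ n in atTop, (t : ℝ) / 2 < u (φ n) (τ L) (col0 t) * mass n L := by
    intro L
    have h := hP L (col0 t)
    rw [mInd_col0, one_mul] at h
    exact h.eventually_const_lt (by linarith)
  have hev2 : ∀ L x, ∀ᶠ n in atTop, |u (φ n) (τ L) x * mass n L / t - mInd x L| < 1 / 100000 := by
    intro L x
    have h := (hP L x).div_const (t : ℝ)
    rw [mul_div_assoc, div_self ht0.ne', mul_one] at h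
    have := Metric.tendsto_nhds.1 h (1 / 100000) (by norm_num)
    simpa only [Real.dist_eq] using this
  have hev : ∀ᶠ n in atTop, (∀ L, (t : ℝ) / 2 < u (φ n) (τ L) (col0 t) * mass n L) ∧
      ∀ L x, |u (φ n) (τ L) x * mass n L / t - mInd x L| < 1 / 100000 := by
    refine (eventually_all.2 hev1).and (eventually_all.2 fun L => eventually_all.2 (hev2 L))
  obtain ⟨n, hn1, hn2⟩ := hev.exists
  -- the rescaled, relabelled factorisation at stage `n`
  have hmpos : ∀ L, 0 < mass n L := by
    intro L
    by_contra hle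
    have hm0 : mass n L = 0 := le_antisymm (not_lt.1 hle) (hmass0 n L)
    have := hn1 L
    rw [hm0, mul_zero] at this
    linarith
  set U : Line t → Col t → ℝ := fun L x => u (φ n) (τ L) x * (mass n L / t) with hU
  set V : Line t → Tri t → ℝ := fun L w => v (φ n) (τ L) w * (t / mass n L) with hV
  have hUV : ∀ L x w, U L x * V L w = u (φ n) (τ L) x * v (φ n) (τ L) w := by
    intro L x w
    simp only [hU, hV]
    field_simp [(hmpos L).ne', ht0.ne']
  have hLF : IsLineFact t (ε (φ n)) (1 / 100000) U V := by
    refine ⟨?_, ?_, ?_, ?_, by norm_num, ?_⟩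
    · intro L x
      exact mul_nonneg ((hNMF (φ n)).u_nonneg _ _) (div_nonneg (hmass0 n L) ht0.le)
    · intro L w
      exact mul_nonneg ((hNMF (φ n)).v_nonneg _ _) (div_nonneg ht0.le (hmass0 n L))
    · intro x w
      simp only [hUV]
      rw [← (hNMF (φ n)).fact x w]
      exact Equiv.sum_comp τ (fun i => u (φ n) i x * v (φ n) i w)
    · intro L
      simp only [hV]
      calc ∑ w, lind L w * (v (φ n) (τ L) w * (t / mass n L))
          = (∑ w, lind L w * v (φ n) (τ L) w) * (t / mass n L) := by
              rw [sum_mul]; exact sum_congr rfl fun w _ => by ring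
        _ = t := by
              change mass n L * (t / mass n L) = t
              field_simp [(hmpos L).ne']
    · intro L x
      simp only [hU]
      have := hn2 L x
      rw [mul_div_assoc] at this
      exact this.le
  have := isolation ht hLF le_rfl
  linarith [hε0 (φ n)]

/-- **Padding.** A factorisation with `R ≤ 3t²` terms indexed by `Fin R` gives one indexed by `Line t` (zero terms added). -/
lemma isNMF_line_of_fin {R : ℕ} (hR : R ≤ 3 * t ^ 2) {ε : ℝ} {u : Fin R → Col t → ℝ} {v : Fin R → Tri t → ℝ}
    (h : IsNMF t ε u v) :
    ∃ (U : Line t → Col t → ℝ) (V : Line t → Tri t → ℝ), IsNMF t ε U V := by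
  classical
  have hcard : Fintype.card (Line t) = 3 * t ^ 2 := by
    simp only [Line, Fintype.card_sum, Fintype.card_prod, Fintype.card_fin]; ring
  -- an embedding `Fin R ↪ Line t`
  have hRle : Fintype.card (Fin R) ≤ Fintype.card (Line t) := by rw [Fintype.card_fin, hcard]; exact hR
  obtain ⟨e⟩ : Nonempty (Fin R ↪ Line t) := Function.Embedding.nonempty_of_card_le hRle
  refine ⟨fun L x => if h : ∃ i, e i = L then u h.choose x else 0,
    fun L w => if h : ∃ i, e i = L then v h.choose w else 0, ?_, ?_, ?_⟩
  · intro L x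
    split_ifs with hL
    · exact h.u_nonneg _ _
    · exact le_rfl
  · intro L w
    split_ifs with hL
    · exact h.v_nonneg _ _
    · exact le_rfl
  · intro x w
    rw [← h.fact x w]
    -- split the sum over lines into the image of `e` and the rest
    have hsplit : ∑ L : Line t, (if h : ∃ i, e i = L then u h.choose x else 0) *
        (if h : ∃ i, e i = L then v h.choose w else 0)
        = ∑ L ∈ (univ : Finset (Fin R)).map e, (if h : ∃ i, e i = L then u h.choose x else 0) *
            (if h : ∃ i, e i = L then v h.choose w else 0) := by
      symm
      refine sum_subset (subset_univ _) fun L _ hL => ?_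
      have : ¬ ∃ i, e i = L := by
        rintro ⟨i, rfl⟩
        exact hL (mem_map_of_mem e (mem_univ i))
      rw [dif_neg this, zero_mul]
    rw [hsplit, sum_map]
    refine sum_congr rfl fun i _ => ?_
    have hex : ∃ j, e j = e i := ⟨i, rfl⟩
    have hch : hex.choose = i := e.injective hex.choose_spec
    rw [dif_pos hex, dif_pos hex, hch]

/-- **Rigidity ⇒ ε-uniform jump**, counted form: under R1 and `t ≥ 3` there is `ε₀ > 0` such that for `0 < ε < ε₀`
no non-negative factorisation of `M_t − εJ` has `R ≤ 3t²` terms, i.e. `rk₊(M_t − εJ) ≥ 3t² + 1` near `0⁺`. -/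
theorem jump_of_lineRigid_fin (ht : 3 ≤ t)
    (hR : ∀ (u : Line t → Col t → ℝ) (v : Line t → Tri t → ℝ), IsNMF t 0 u v →
      ∃ σ : Equiv.Perm (Line t), ∀ L x w, u L x * v L w = mInd x (σ L) * lind (σ L) w) :
    ∃ ε₀ : ℝ, 0 < ε₀ ∧ ∀ ε : ℝ, 0 < ε → ε < ε₀ → ∀ R : ℕ, R ≤ 3 * t ^ 2 →
      ∀ (u : Fin R → Col t → ℝ) (v : Fin R → Tri t → ℝ), ¬ IsNMF t ε u v := by
  obtain ⟨ε₀, hε₀, h⟩ := jump_of_lineRigid ht hR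
  refine ⟨ε₀, hε₀, fun ε hε hε' R hRle u v hN => ?_⟩
  obtain ⟨U, V, hUV⟩ := isNMF_line_of_fin hRle hN
  exact h ε hε hε' U V hUV

/-! ## The registered form (self-contained signature) -/

/-- the line pattern of a row, written out -/
lemma mInd_eq_elim (x : Col t) (L : Line t) : mInd x L =
    Sum.elim (fun ab : Fin t × Fin t => if x.1 ab.1 = x.2.1 ab.2 then (1 : ℝ) else 0)
      (Sum.elim (fun ad : Fin t × Fin t => if x.1 ad.1 = x.2.2 ad.2 then (1 : ℝ) else 0)
        (fun bd : Fin t × Fin t => if x.2.1 bd.1 = x.2.2 bd.2 then (1 : ℝ) else 0)) L := by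
  rcases L with ⟨a, b⟩ | ⟨a, d⟩ | ⟨b, d⟩ <;> simp [mInd]

/-- the indicator of a line, written out -/
lemma lind_eq_elim (L : Line t) (w : Tri t) : lind L w =
    Sum.elim (fun ab : Fin t × Fin t => if w.1 = ab.1 ∧ w.2.1 = ab.2 then (1 : ℝ) else 0)
      (Sum.elim (fun ad : Fin t × Fin t => if w.1 = ad.1 ∧ w.2.2 = ad.2 then (1 : ℝ) else 0)
        (fun bd : Fin t × Fin t => if w.2.1 = bd.1 ∧ w.2.2 = bd.2 then (1 : ℝ) else 0)) L := by
  rcases L with ⟨a, b⟩ | ⟨a, d⟩ | ⟨b, d⟩ <;> simp [lind]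

/-- **Rigidity of the cheap corner ⇒ ε-uniform strict-rank jump on the triangle instance** (registered sub-goal
`triangle_jump_of_rigidity` of stmt-PneNP-10680, verbatim signature). Rows `x ∈ (Fin t → Bool)³`, columns `w ∈ (Fin t)³`,
`M_t[x,w]` = the three `if`s (number of monochromatic edges of the transversal triangle `w`); lines are indexed by
`(Fin t × Fin t) ⊕ (Fin t × Fin t) ⊕ (Fin t × Fin t)` (`inl (a,b)` = `{(a,b,·)}`, `inr (inl (a,d))` = `{(a,·,d)}`,
`inr (inr (b,d))` = `{(·,b,d)}`). HYPOTHESIS (R1, rigidity at `ε = 0`): every non-negative factorisation of `M_t` with terms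
indexed by the lines is, up to a permutation `σ` of the indices, the line factorisation term by term. CONCLUSION: for some
`ε₀ > 0` and all `ε ∈ (0, ε₀)`, `M_t − εJ` has no non-negative factorisation with `R ≤ 3t²` terms (`t ≥ 3`). -/
theorem triangle_jump_of_rigidity : ∀ (t : ℕ), 3 ≤ t → (∀ (u : (Fin t × Fin t) ⊕ (Fin t × Fin t) ⊕ (Fin t × Fin t) →
    (Fin t → Bool) × (Fin t → Bool) × (Fin t → Bool) → ℝ) (v : (Fin t × Fin t) ⊕ (Fin t × Fin t) ⊕ (Fin t × Fin t) →
    Fin t × Fin t × Fin t → ℝ), (∀ L x, 0 ≤ u L x) → (∀ L w, 0 ≤ v L w) → (∀ x w, ∑ L, u L x * v L w = ((if x.1 w.1 =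
    x.2.1 w.2.1 then 1 else 0) + (if x.1 w.1 = x.2.2 w.2.2 then 1 else 0) + (if x.2.1 w.2.1 = x.2.2 w.2.2 then 1 else 0)
    : ℝ)) → ∃ σ : Equiv.Perm ((Fin t × Fin t) ⊕ (Fin t × Fin t) ⊕ (Fin t × Fin t)), ∀ L x w, u L x * v L w = Sum.elim
    (fun ab : Fin t × Fin t => if x.1 ab.1 = x.2.1 ab.2 then (1 : ℝ) else 0) (Sum.elim (fun ad : Fin t × Fin t => if
    x.1 ad.1 = x.2.2 ad.2 then (1 : ℝ) else 0) (fun bd : Fin t × Fin t => if x.2.1 bd.1 = x.2.2 bd.2 then (1 : ℝ) else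
    0)) (σ L) * Sum.elim (fun ab : Fin t × Fin t => if w.1 = ab.1 ∧ w.2.1 = ab.2 then (1 : ℝ) else 0) (Sum.elim (fun
    ad : Fin t × Fin t => if w.1 = ad.1 ∧ w.2.2 = ad.2 then (1 : ℝ) else 0) (fun bd : Fin t × Fin t => if w.2.1 = bd.1
    ∧ w.2.2 = bd.2 then (1 : ℝ) else 0)) (σ L)) → ∃ ε₀ : ℝ, 0 < ε₀ ∧ ∀ ε : ℝ, 0 < ε → ε < ε₀ → ∀ R : ℕ, R ≤ 3 * t ^ 2
    → ∀ (u : Fin R → (Fin t → Bool) × (Fin t → Bool) × (Fin t → Bool) → ℝ) (v : Fin R → Fin t × Fin t × Fin t → ℝ),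
    (∀ i x, 0 ≤ u i x) → (∀ i w, 0 ≤ v i w) → ¬ (∀ x w, ∑ i, u i x * v i w = ((if x.1 w.1 = x.2.1 w.2.1 then 1 else
    0) + (if x.1 w.1 = x.2.2 w.2.2 then 1 else 0) + (if x.2.1 w.2.1 = x.2.2 w.2.2 then 1 else 0) : ℝ) - ε) := by
  intro t ht hR
  have hR' : ∀ (u : Line t → Col t → ℝ) (v : Line t → Tri t → ℝ), IsNMF t 0 u v →
      ∃ σ : Equiv.Perm (Line t), ∀ L x w, u L x * v L w = mInd x (σ L) * lind (σ L) w := by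
    intro u v h
    obtain ⟨σ, hσ⟩ := hR u v h.u_nonneg h.v_nonneg fun x w => by
      rw [h.fact x w, sub_zero]; simp only [monoCount]; push_cast; ring
    refine ⟨σ, fun L x w => ?_⟩
    rw [hσ L x w, mInd_eq_elim, lind_eq_elim]
  obtain ⟨ε₀, hε₀, h⟩ := jump_of_lineRigid_fin ht hR'
  refine ⟨ε₀, hε₀, fun ε hε hε' R hRle u v hu hv hf => h ε hε hε' R hRle u v ⟨hu, hv, fun x w => ?_⟩⟩
  rw [hf x w]; simp only [monoCount]; push_cast; ring

end

end Summit.PneNP.PneNP.Theorems.XorDoor.TriLine
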